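import Summits.ValiantsHypothesis.ValiantsHypothesis.Theorems.LacunarySymmetroidMatrixDescartesCensusPivotBlockSum
import Summits.ValiantsHypothesis.ValiantsHypothesis.Theorems.LacunarySymmetroidMatrixDescartesNsdPivotSharp
import Summits.ValiantsHypothesis.ValiantsHypothesis.Theorems.LacunarySymmetroidMatrixDescartesNsdPivotThreeSix

/-!
# `MatrixDescartes` (stmt-ValiantsHypothesis-18050) — NSD-pivot counts are SUPERADDITIVE in the size:
# at every even size `n` some pivot pencil with `J ⪯ 0` and FOUR PSD letters has `4n` positive roots (`= 2·(2n)`), and THREE letters give `3n`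

HONEST FRAMING.  Cell `pub-symmetroid`, seat `val-sym-mdr-p2` (gen 11); helper file `--supports` the crux
`Theses.LacunarySymmetroid.MatrixDescartes` (OPEN), NO closure claim.  Seventh file of the session's NSD-pivot series.  The `n = 2` objects
of `…NsdPivotSharp` (`Z₊ = 8`, four letters) and `…NsdPivotThreeSix` (`Z₊ = 6`, three letters) are transported to ALL EVEN SIZES by the
block-sum technique of this seat's gen 7 (`Pivot.BlockSum`: block-diagonal sum with a generic rescaling `x ↦ c·x` of the second summand so
that the positive root sets are disjoint; the determinant multiplies, the counts add).  What is new is only the bookkeeping that the pivot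
stays NEGATIVE SEMIDEFINITE under block sums and positive rescaling (`−blk[J, c^e J'] = blk[−J, c^e(−J')] ⪰ 0`).  Consequences:
* **`exists_nsd_four_letters` :** for every `j`, some `(2j) × (2j)` pivot pencil with `J ⪯ 0` and four PSD letters (support `(20; 21,19,0,40)`)
  has `≥ 8j` distinct positive determinant roots — so the K-free NSD-pivot law «`Z₊ ≤ 2n`» located by gen 10 fails at EVERY even size `n`
  by a factor of two (`4n` attained with `K = 4`), **`not_nsdPivotLaw_even`**;
* **`exists_nsd_three_letters` :** three PSD letters (support `(1; 0,2,21)`) give `≥ 6j = 3n`.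
Nothing here bears on `MatrixDescartes` in its window (these are `K ≤ 4` rows, far below `ζ_sym`), on `DoorA26` / `DoorA34`, on the cell's
registers, or on `VP ≠ VNP`.

[folklore] Elementary: the tree's `Pivot.BlockSum.{det_pencil_blk, eval_det_pivot_scale, pivotPosRoots_scale}`,
`WLawBlockSum.{exists_scale_disjoint, card_posRoots_mul_of_disjoint, isSymm_blk, posSemidef_blk}`, Mathlib block matrices.
-/

-- `Summit.ValiantsHypothesis.ValiantsHypothesis.…` repeats a component by the D-0017 layout
-- (single-conjunct summit), which the `dupNamespace` linter flags; the name is mandated.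
set_option linter.dupNamespace false

namespace Summit.ValiantsHypothesis.ValiantsHypothesis.Theorems.LacunarySymmetroidMatrixDescartes.Pivot

open scoped BigOperators Matrix
open Polynomial

namespace NsdBlockSum

/-- The block-diagonal sum of two letters, reindexed to `Fin (a + b)`. -/
local notation3 (prettyPrint := false) "blk[" A ", " B "]" =>
  Matrix.reindex finSumFinEquiv finSumFinEquiv (Matrix.fromBlocks A 0 0 B)

/-- «some `n × n` pivot pencil on the support `(e; d)` with NEGATIVE SEMIDEFINITE pivot letter has `≥ A` positive roots» -/
local notation3 (prettyPrint := false) "NAtt[" e ", " d ", " n ", " A "]" =>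
  ∃ (J : Matrix (Fin n) (Fin n) ℝ) (P : Fin _ → Matrix (Fin n) (Fin n) ℝ),
    J.IsSymm ∧ (∀ k, (P k).PosSemidef) ∧ (-J).PosSemidef ∧ A ≤ pivotPosRoots e d J P

/-- A block sum of NSD pivot letters, the second positively rescaled, is NSD: `−blk[J, c • J'] = blk[−J, c • (−J')] ⪰ 0`.
[folklore] -/
theorem neg_blk_posSemidef {a b : ℕ} {J : Matrix (Fin a) (Fin a) ℝ} {J' : Matrix (Fin b) (Fin b) ℝ}
    (h : (-J).PosSemidef) (h' : (-J').PosSemidef) {c : ℝ} (hc : 0 ≤ c) : (-blk[J, c • J']).PosSemidef := by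
  have e1 : -blk[J, c • J'] = blk[-J, c • (-J')] := by
    rw [Matrix.reindex_apply, Matrix.reindex_apply]
    ext i j
    simp only [Matrix.neg_apply, Matrix.submatrix_apply]
    rw [← Matrix.neg_apply, Matrix.fromBlocks_neg, neg_zero, smul_neg]
    simp only [neg_zero]
  rw [e1]
  exact WLawBlockSum.posSemidef_blk h (h'.smul hc)

/-- From an NSD attainability witness extract one whose determinant is a NONZERO polynomial (a vanishing determinant certifies
only `0`; then use `J = −1`, `P = 0`: `det = (−X^e)^n ≠ 0`, `−J = 1 ⪰ 0`). [folklore] -/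
theorem exists_witness_det_ne_zero {n K A : ℕ} (e : ℕ) (d : Fin K → ℕ) (h : NAtt[e, d, n, A]) :
    ∃ (J : Matrix (Fin n) (Fin n) ℝ) (P : Fin K → Matrix (Fin n) (Fin n) ℝ),
      J.IsSymm ∧ (∀ k, (P k).PosSemidef) ∧ (-J).PosSemidef ∧
      Matrix.det (((X : ℝ[X]) ^ e) • J.map Polynomial.C + ∑ k, ((X : ℝ[X]) ^ d k) • (P k).map Polynomial.C) ≠ 0 ∧
      A ≤ pivotPosRoots e d J P := by
  obtain ⟨J, P, hJ, hP, hN, hA⟩ := h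
  by_cases hdet : Matrix.det (((X : ℝ[X]) ^ e) • J.map Polynomial.C
      + ∑ k, ((X : ℝ[X]) ^ d k) • (P k).map Polynomial.C) = 0
  · have hA0 : A = 0 := by
      unfold pivotPosRoots at hA
      rw [hdet, Polynomial.roots_zero, Multiset.toFinset_zero, Finset.filter_empty, Finset.card_empty,
        Nat.le_zero] at hA
      exact hA
    subst hA0
    refine ⟨-1, fun _ => 0, Matrix.isSymm_one.neg, fun _ => Matrix.PosSemidef.zero, ?_, ?_, Nat.zero_le _⟩
    · rw [neg_neg]; exact Matrix.PosSemidef.one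
    · have h1 : ((X : ℝ[X]) ^ e) • (-1 : Matrix (Fin n) (Fin n) ℝ).map Polynomial.C
          + ∑ k, ((X : ℝ[X]) ^ d k) • (0 : Matrix (Fin n) (Fin n) ℝ).map Polynomial.C
          = (-((X : ℝ[X]) ^ e)) • (1 : Matrix (Fin n) (Fin n) ℝ[X]) := by
        simp [Matrix.map_zero _ Polynomial.C_0, Matrix.map_neg]
      rw [h1, Matrix.det_smul, Matrix.det_one, mul_one, Fintype.card_fin]
      exact pow_ne_zero _ (neg_ne_zero.2 (pow_ne_zero _ Polynomial.X_ne_zero))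
  · exact ⟨J, P, hJ, hP, hN, hdet, hA⟩

/-- **SUPERADDITIVITY OF ATTAINABLE NSD-PIVOT COUNTS** (fixed support `(e; d)`, fixed number of letters): sizes add, counts add,
the pivot stays negative semidefinite. [folklore] -/
theorem superadditive {a b K A B : ℕ} (e : ℕ) (d : Fin K → ℕ)
    (ha : NAtt[e, d, a, A]) (hb : NAtt[e, d, b, B]) : NAtt[e, d, a + b, A + B] := by
  obtain ⟨J, P, hJ, hP, hN, hpne, hA⟩ := exists_witness_det_ne_zero e d ha
  obtain ⟨J', P', hJ', hP', hN', hqne, hB⟩ := exists_witness_det_ne_zero e d hb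
  set p := Matrix.det (((X : ℝ[X]) ^ e) • J.map Polynomial.C + ∑ k, ((X : ℝ[X]) ^ d k) • (P k).map Polynomial.C)
    with hp
  set pq := Matrix.det (((X : ℝ[X]) ^ e) • J'.map Polynomial.C + ∑ k, ((X : ℝ[X]) ^ d k) • (P' k).map Polynomial.C)
    with hpq
  obtain ⟨c, hc, hsep⟩ := WLawBlockSum.exists_scale_disjoint p pq
  set qc := Matrix.det (((X : ℝ[X]) ^ e) • (c ^ e • J').map Polynomial.C
      + ∑ k, ((X : ℝ[X]) ^ d k) • (c ^ d k • P' k).map Polynomial.C) with hqc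
  have hqc_eval : ∀ x, qc.eval x = pq.eval (c * x) := fun x => BlockSum.eval_det_pivot_scale e d J' P' c x
  have hqcne : qc ≠ 0 := by
    intro h0
    apply hqne
    refine Polynomial.funext fun y => ?_
    have := hqc_eval (y / c)
    rw [h0, mul_div_cancel₀ y hc.ne'] at this
    simpa using this.symm
  have hdis : Disjoint (p.roots.toFinset.filter (fun t => 0 < t)) (qc.roots.toFinset.filter (fun t => 0 < t)) := by
    rw [Finset.disjoint_left]
    intro x hxp hxq
    rw [Finset.mem_filter] at hxp hxq
    refine hsep x hxp.2 hxp.1 ?_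
    rw [Multiset.mem_toFinset, Polynomial.mem_roots hqne, Polynomial.IsRoot.def, ← hqc_eval]
    exact (Polynomial.mem_roots hqcne).1 (Multiset.mem_toFinset.1 hxq.1)
  have hB' : B ≤ ((qc.roots.toFinset.filter (fun t => 0 < t))).card := by
    have h := BlockSum.pivotPosRoots_scale e d J' P' hc
    unfold pivotPosRoots at h hB
    rw [← hqc] at h
    rw [h]
    exact hB
  have hA' : A ≤ ((p.roots.toFinset.filter (fun t => 0 < t))).card := by
    unfold pivotPosRoots at hA
    exact hA
  refine ⟨blk[J, c ^ e • J'], fun k => blk[P k, c ^ d k • P' k],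
    WLawBlockSum.isSymm_blk hJ (hJ'.smul _), fun k => WLawBlockSum.posSemidef_blk (hP k) ((hP' k).smul (pow_nonneg hc.le _)),
    neg_blk_posSemidef hN hN' (pow_nonneg hc.le e), ?_⟩
  unfold pivotPosRoots
  rw [BlockSum.det_pencil_blk, ← hp, ← hqc, WLawBlockSum.card_posRoots_mul_of_disjoint p qc hpne hqcne hdis]
  exact Nat.add_le_add hA' hB'

/-- Transport of attainability along an equality of sizes. [bookkeeping] -/
theorem natt_cast {K n n' A : ℕ} (e : ℕ) (d : Fin K → ℕ) (hn : n = n') (h : NAtt[e, d, n, A]) : NAtt[e, d, n', A] := by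
  subst hn
  exact h

/-- **Self-sums**: an NSD witness with `A` roots at size `m` gives, for every `j`, an NSD witness with `j·A` roots at size `j·m`
(same support, same letters count). [folklore] -/
theorem natt_mul {K m A : ℕ} (e : ℕ) (d : Fin K → ℕ) (h : NAtt[e, d, m, A]) (j : ℕ) : NAtt[e, d, j * m, j * A] := by
  induction j with
  | zero =>
    rw [Nat.zero_mul, Nat.zero_mul]
    exact ⟨0, fun _ => 0, Matrix.isSymm_zero, fun _ => Matrix.PosSemidef.zero, by simpa using Matrix.PosSemidef.zero,
      Nat.zero_le _⟩
  | succ j ih =>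
    have h2 := superadditive e d ih h
    rw [← Nat.succ_mul j A] at h2
    exact natt_cast e d (Nat.succ_mul j m).symm h2

/-- The `n = 2` generator with FOUR letters: `Z₊ ≥ 8` (`…NsdPivotSharp`). [folklore] -/
theorem natt_two_four : NAtt[20, (![21, 19, 0, 40] : Fin 4 → ℕ), 2, 8] :=
  ⟨_, _, NsdPivotSharp.J_isSymm, NsdPivotSharp.P_posSemidef, NsdPivotSharp.neg_J_posSemidef,
    NsdPivotSharp.eight_le_pivotPosRoots⟩

/-- The `n = 2` generator with THREE letters: `Z₊ ≥ 6` (`…NsdPivotThreeSix`). [folklore] -/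
theorem natt_two_three : NAtt[1, (![0, 2, 21] : Fin 3 → ℕ), 2, 6] :=
  ⟨_, _, NsdPivotThreeSix.J_isSymm, NsdPivotThreeSix.P_posSemidef, NsdPivotThreeSix.neg_J_posSemidef,
    NsdPivotThreeSix.six_le_pivotPosRoots⟩

end NsdBlockSum

open NsdBlockSum in
/-- **`4n` WITH FOUR LETTERS AT EVERY EVEN SIZE**: for every `j`, some `(2j) × (2j)` pivot pencil with a negative semidefinite pivot
letter and four PSD letters (support `(20; 21, 19, 0, 40)`) has at least `8j` distinct positive determinant roots. [folklore] -/
theorem exists_nsd_four_letters (j : ℕ) :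
    ∃ (J : Matrix (Fin (j * 2)) (Fin (j * 2)) ℝ) (P : Fin 4 → Matrix (Fin (j * 2)) (Fin (j * 2)) ℝ),
      J.IsSymm ∧ (∀ k, (P k).PosSemidef) ∧ (-J).PosSemidef ∧
        j * 8 ≤ pivotPosRoots 20 (![21, 19, 0, 40] : Fin 4 → ℕ) J P :=
  natt_mul 20 _ natt_two_four j

open NsdBlockSum in
/-- **`3n` WITH THREE LETTERS AT EVERY EVEN SIZE**: for every `j`, some `(2j) × (2j)` pivot pencil with a negative semidefinite pivot
letter and three PSD letters (support `(1; 0, 2, 21)`) has at least `6j` distinct positive determinant roots. [folklore] -/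
theorem exists_nsd_three_letters (j : ℕ) :
    ∃ (J : Matrix (Fin (j * 2)) (Fin (j * 2)) ℝ) (P : Fin 3 → Matrix (Fin (j * 2)) (Fin (j * 2)) ℝ),
      J.IsSymm ∧ (∀ k, (P k).PosSemidef) ∧ (-J).PosSemidef ∧
        j * 6 ≤ pivotPosRoots 1 (![0, 2, 21] : Fin 3 → ℕ) J P :=
  natt_mul 1 _ natt_two_three j

/-- **THE K-FREE NSD-PIVOT LAW FAILS AT EVERY EVEN SIZE, BY A FACTOR OF TWO**: for `n = 2j ≥ 2` it is not the case that every
`n × n` pivot pencil with a negative semidefinite pivot letter and PSD letters has at most `4n − 1` (let alone `2n`) distinct positive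
determinant roots. [folklore] -/
theorem not_nsdPivotLaw_even {j : ℕ} (hj : 1 ≤ j) :
    ¬ (∀ (K e : ℕ) (d : Fin K → ℕ) (J : Matrix (Fin (j * 2)) (Fin (j * 2)) ℝ) (P : Fin K → Matrix (Fin (j * 2)) (Fin (j * 2)) ℝ),
        J.IsSymm → (-J).PosSemidef → (∀ k, (P k).PosSemidef) → pivotPosRoots e d J P ≤ 4 * (j * 2) - 1) := by
  intro h
  obtain ⟨J, P, hJ, hP, hN, h8⟩ := exists_nsd_four_letters j
  have := le_trans h8 (h 4 20 _ J P hJ hN hP)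
  omega

end Summit.ValiantsHypothesis.ValiantsHypothesis.Theorems.LacunarySymmetroidMatrixDescartes.Pivot
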